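import Summits.HodgeConjecture.CorCM.AndreWeakFormHolds
import Summits.HodgeConjecture.HodgeConjecture.Theorems.Ring2Hypotheses
import Summits.HodgeConjecture.HodgeConjecture.Theorems.Ring2HypothesesGermDomination
import Summits.HodgeConjecture.HodgeConjecture.Theorems.Ring2AbelianAllWeilColumn
import HarnessLib

/-!
# Ring 2 — the stage-2 / stage-3 seam: the Weil rung R3 in place of `HC_CM`, record-free

HONEST FRAMING (page 1, verbatim the cell's standing line): **research route conditional on HC_CM; not a
corollary; Q11.4-sentence-2 already refuted in dim ≥ 3.** Nothing in this file proves a case of the Hodge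
conjecture; `HC_CM` (`Theses.RankFourFaces.CMAbelianHodge`) and `HC_AV`
(`Theses.PadicSemiregularLift.HodgeAbelianVarieties`) occur BY NAME only, never restated, never asserted; every
rung / binder (`WeilTypeLadder.WeilClassesCMField` = R3, `MumfordTateCMAnchors` = row b01, `AbelianSchemeVHC` = b02,
`CMAnchoredFamilies` = b07, `LocalVHCAtCM` = b08, the transport leaves, the LEAD grammar's candidates `B`) is a
HYPOTHESIS wherever it occurs.

Stage 2 of the Hodge ladder (cell `pub-hodgecm2`, COR-CM) has PROVED IN THE TREE, with no record in print left as
a hypothesis: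

* Riemann's theorem (Deligne–Milne 1982 Thm. 6.20, fullness of `A ↦ H¹_B(A)`):
  `HodgeTheory.deligneMilne1982_Thm_6_20_full_holds` (`Literature/…/AbelianVarietyHodgeFullnessHolds.lean`, p244037);
* André 1992 (= Charles–Schnell Thm. 11.5.21 = Milne's endnote M.12), the ring-2 record `h𝔄` / `hA` — C-row c3 of
  `BINDER-OWNERS.md`: `CorCM.AndreWeakForm.andre1992_hodgeClasses_cmAbelianVariety_mem_span_pullback_weilClasses_holds`
  (`CorCM/AndreWeakFormHolds.lean`, p244726, gate «net debt −1»);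
* hence André's theorem in CLOSED FORM: **the rung R3 ALONE implies `HC_CM`** —
  `CorCM.AndreWeakForm.hc_cm_of_riemann_of_weilClassesCMField` at `…_full_holds` (equivalently
  `CorCM.Milne2020.hc_cm_of_weilClassesCMField`): no André record, no imaginary-quadratic rung R∞, no CM-existence
  record.

Ring 2 consumes `HC_CM` BY NAME, so these stage-2 theorems flow back through the seam. This file is the binder
seat's (row b01) kernel record of what they do to the ring-2 rows in which `HC_CM` stands next to the Weil rung —
term reuse only, 0 lines of mathematics beyond one-term applications, COUNT ONCE (the discharges are cell
pub-hodgecm2's):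

* §0 `hc_cm_of_weilClassesCMField : R3 → HC_CM` — the closed-form theorem under the ring-2 dictionary namespace
  (until now no bare edge `R3 ⟹ HC_CM` existed in namespace `Summit.HodgeConjecture.HodgeConjecture`; the transport /
  deform rows carry extra leaves or the binder `hR`).
* §1 ROW b01's LINE with R3 in place of `HC_CM`: `R3 ∧ MumfordTateCMAnchors ∧ AbelianSchemeVHC ⟹ HC_AV`, the `VHC` /
  `FlatSectionsAlgebraic` variants, exactness `HC_AV ↔ R3 ∧ AbelianSchemeVHC` granted the anchors, and the cell's ITEM:
  `HC_AV ↔ R3 ∧ CMToAbelian` (stmt-HodgeConjecture-16267), all FACT-FREE.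
* §2 THE CM-PIVOT LINE (rows b07 / b08) with R3 in place of `HC_CM`: `R3 ∧ CMAnchoredFamilies ∧ LocalVHCAtCM ⟹ HC_AV`;
  part XIII's G3 / G4 lose BOTH the André record and the imaginary-quadratic anchor leaf:
  `DivisorGeneratedCMPointedWeilFamiliesCMField ∧ LocalVHCAtCM ⟹ HC_CM` and `… ∧ CMAnchoredFamilies ⟹ HC_AV`.
* §3 THE LEAD GRAMMAR (`Theorems/Ring2AbelianAllFrame.lean`): every closing row `ClosesWithCM B` has the `HC_CM`-free
  twin `R3 → B → HC_AV` and every exact `B` reads `HC_AV ↔ R3 ∧ B`, FACT-FREE (the Weil column's §2 had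
  `R∞ → R3 → B → HC_AV` modulo André 1992); the Weil column's exactness instance AS FILED,
  `HC_AV ↔ R∞ ∧ R3 ∧ CMToAbelian`, with André's record supplied by the stage-2 theorem.

CENSUS NOTE (typer1's edge census, v53: universe = import closure of `Theorems/Ring2*`): this file brings
`CorCM/AndreWeakFormHolds.lean` into that closure, so the record c3 — discharged in the tree since p244726 but
one of the «47» of v53 — is discharged IN THE CONE as well (the `Mumford_curveLemma_affine` precedent of v52 → v53).

No definition, no new named fact, no `sorry`, no `HC_CM` restatement; standard axioms only.

References (bib keys): Andre1992HodgeCM (Théorème, p. 2); DeligneMilne1982Tannakian (§6 Thm. 6.20);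
Deligne1982HodgeCycles (Prop. 6.1; Milne 2003 re-edition endnotes M.12, 19); CharlesSchnell2014Notes (Thm. 11.5.11,
Thm. 11.5.21, Conj. 11.3.1, Cor. 11.3.6); Markman2025SurveySecant (Thm. 1.4, §12); Milne2020HodgeClassesAV (§3 Thm. 1).
-/

set_option linter.dupNamespace false

noncomputable section

namespace Summit.HodgeConjecture.HodgeConjecture.Ring2.Hypotheses

open Literature.AlgebraicGeometry Literature.AlgebraicGeometry.Motives
open Literature.AlgebraicGeometry.HodgeTheory
open Summit.HodgeConjecture.CorCM

/-! ## §0 Stage 2's closed-form André theorem, by name -/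

/-- **R3 ALONE ⟹ `HC_CM`, no record** (André 1992 in closed form, as proved by cell pub-hodgecm2): the Weil classes
for CM fields `K` with `[K:ℚ] > 2` being algebraic (`WeilTypeLadder.WeilClassesCMField`, rung R3 of the B2b ladder)
implies the Hodge conjecture for every complex abelian variety of CM type. Term reuse of
`CorCM.AndreWeakForm.hc_cm_of_riemann_of_weilClassesCMField` with Riemann's theorem supplied by the tree theorem
`deligneMilne1982_Thm_6_20_full_holds`; count once cell pub-hodgecm2. [cite: Andre1992HodgeCM, Théorème and p. 2]
[cite: DeligneMilne1982Tannakian, §6 Thm. 6.20] [cite: Milne2020HodgeClassesAV, §3 Thm. 1] -/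
theorem hc_cm_of_weilClassesCMField (h₃ : WeilTypeLadder.WeilClassesCMField) : Theses.RankFourFaces.CMAbelianHodge :=
  AndreWeakForm.hc_cm_of_riemann_of_weilClassesCMField deligneMilne1982_Thm_6_20_full_holds h₃

/-! ## §1 Row b01's line with the rung R3 in place of `HC_CM` (fact-free) -/

/-- **`R3 ∧ MumfordTateCMAnchors ∧ AbelianSchemeVHC ⟹ HC_AV`** — §1b's global-base row
`hc_av_of_hc_cm_of_mumfordTateCMAnchors_of_abelianSchemeVHC` with `HC_CM` supplied by the rung (§0). No record in
print is a hypothesis: the open inputs are R3, row b01 (Deligne Prop. 6.1 / Charles–Schnell Thm. 11.5.11, a theorem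
in print, binder in Lean) and row b02. [cite: CharlesSchnell2014Notes, Thm. 11.5.11 and Conj. 11.3.1]
[cite: Andre1992HodgeCM, Théorème] -/
theorem hc_av_of_weilClassesCMField_of_mumfordTateCMAnchors_of_abelianSchemeVHC
    (h₃ : WeilTypeLadder.WeilClassesCMField) (hAn : MumfordTateCMAnchors) (hV : AbelianSchemeVHC) :
    Theses.PadicSemiregularLift.HodgeAbelianVarieties :=
  hc_av_of_hc_cm_of_mumfordTateCMAnchors_of_abelianSchemeVHC (hc_cm_of_weilClassesCMField h₃) hAn hV

/-- **Exactness of row b01's line with the rung: granted `MumfordTateCMAnchors`, `HC_AV ↔ R3 ∧ AbelianSchemeVHC`**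
(§1b's `hc_av_iff_hc_cm_and_abelianSchemeVHC` with `HC_CM` replaced by R3; both conjuncts are ON PATH).
[cite: CharlesSchnell2014Notes, Cor. 11.3.6 and Thm. 11.5.11] [cite: Andre1992HodgeCM, Théorème] -/
theorem hc_av_iff_weilClassesCMField_and_abelianSchemeVHC (hAn : MumfordTateCMAnchors) :
    Theses.PadicSemiregularLift.HodgeAbelianVarieties ↔ WeilTypeLadder.WeilClassesCMField ∧ AbelianSchemeVHC :=
  ⟨fun h => ⟨AbelianAll.onPathAV_weilClassesCMField h, abelianSchemeVHC_of_hc_av h⟩,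
    fun h => hc_av_of_weilClassesCMField_of_mumfordTateCMAnchors_of_abelianSchemeVHC h.1 hAn h.2⟩

/-- … with the GENERAL variational Hodge conjecture (item 1076) in place of its abelian instance:
`R3 ∧ MumfordTateCMAnchors ∧ VHC ⟹ HC_AV`. [cite: Grothendieck1966, footnote 13] [cite: Andre1992HodgeCM, Théorème] -/
theorem hc_av_of_weilClassesCMField_of_mumfordTateCMAnchors_of_vhc
    (h₃ : WeilTypeLadder.WeilClassesCMField) (hAn : MumfordTateCMAnchors)
    (hV : Theses.AnchorTransport.VariationalHodge) : Theses.PadicSemiregularLift.HodgeAbelianVarieties :=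
  hc_av_of_hc_cm_of_mumfordTateCMAnchors_of_vhc (hc_cm_of_weilClassesCMField h₃) hAn hV

/-- … and with the FLAT-SECTION form of Conj. 11.3.1 (row b04): `R3 ∧ MumfordTateCMAnchors ∧ FlatSectionsAlgebraic ⟹ HC_AV`.
[cite: CharlesSchnell2014Notes, Conj. 11.3.1 and Thm. 11.5.11] [cite: Andre1992HodgeCM, Théorème] -/
theorem hc_av_of_weilClassesCMField_of_mumfordTateCMAnchors_of_flatSectionsAlgebraic
    (h₃ : WeilTypeLadder.WeilClassesCMField) (hAn : MumfordTateCMAnchors) (hF : FlatSectionsAlgebraic) :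
    Theses.PadicSemiregularLift.HodgeAbelianVarieties :=
  hc_av_of_hc_cm_of_mumfordTateCMAnchors_of_flatSectionsAlgebraic (hc_cm_of_weilClassesCMField h₃) hAn hF

/-- **The cell's ITEM with the rung: `R3 ∧ CMToAbelian ⟹ HC_AV`** (`Theses.RankFourFaces.CMToAbelian`,
stmt-HodgeConjecture-16267, is `HC_CM → ∀ A, …`; feed it `HC_CM` from §0). Fact-free.
[cite: Andre1992HodgeCM, Théorème] [cite: Markman2025SurveySecant, Thm. 1.4 and §12] -/
theorem hc_av_of_weilClassesCMField_of_cmToAbelian (h₃ : WeilTypeLadder.WeilClassesCMField)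
    (hT : Theses.RankFourFaces.CMToAbelian) : Theses.PadicSemiregularLift.HodgeAbelianVarieties :=
  hc_av_iff_hc_cm_and_cmToAbelian.2 ⟨hc_cm_of_weilClassesCMField h₃, hT⟩

/-- **Exactness of the item with the rung: `HC_AV ↔ R3 ∧ CMToAbelian`, FACT-FREE** — the item-16267 typing
`HC_AV ↔ HC_CM ∧ CMToAbelian` (`hc_av_iff_hc_cm_and_cmToAbelian`) with `HC_CM` replaced by the rung R3; the Weil
column's `iff_weilRungs_and_cmToAbelian` without the imaginary-quadratic rung and without André's record.
[cite: Andre1992HodgeCM, Théorème and p. 2] [cite: Markman2025SurveySecant, Thm. 1.4 and §12] -/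
theorem hc_av_iff_weilClassesCMField_and_cmToAbelian :
    Theses.PadicSemiregularLift.HodgeAbelianVarieties ↔
      WeilTypeLadder.WeilClassesCMField ∧ Theses.RankFourFaces.CMToAbelian :=
  ⟨fun h => ⟨AbelianAll.onPathAV_weilClassesCMField h, (hc_av_iff_hc_cm_and_cmToAbelian.1 h).2⟩,
    fun h => hc_av_of_weilClassesCMField_of_cmToAbelian h.1 h.2⟩

/-! ## §2 The CM-pivot line (rows b07 / b08) with the rung R3 in place of `HC_CM` (fact-free) -/

/-- **`R3 ∧ CMAnchoredFamilies ∧ LocalVHCAtCM ⟹ HC_AV`** — part II §A's CM-pivot row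
`hc_av_of_hc_cm_of_cmAnchoredFamilies_of_localVHCAtCM` with `HC_CM` supplied by the rung: on the CM-pivot line
`HC_CM` is dominated by R3 with NO record and NO anchor leaf (compare part XIII G4: modulo André 1992 and two
divisor-generated anchor leaves). [cite: Deligne1982HodgeCycles, Prop. 6.1] [cite: CharlesSchnell2014Notes, Thm. 11.3.17]
[cite: Andre1992HodgeCM, Théorème] -/
theorem hc_av_of_weilClassesCMField_of_cmAnchoredFamilies_of_localVHCAtCM
    (h₃ : WeilTypeLadder.WeilClassesCMField) (hMT : CMAnchoredFamilies) (hV : LocalVHCAtCM) :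
    Theses.PadicSemiregularLift.HodgeAbelianVarieties :=
  hc_av_of_hc_cm_of_cmAnchoredFamilies_of_localVHCAtCM (hc_cm_of_weilClassesCMField h₃) hMT hV

/-- **G3′ — `HC_CM` from the CM-pivot germ and the CM-FIELD anchor leaf alone**: part XIII's G2
(`HC_WeilClassesCMField_of_divisorGeneratedCMPointed_of_localVHCAtCM : … → R3`) followed by §0. Compared with G3
(`HC_CM_of_andre_of_divisorGeneratedCMPointed_of_localVHCAtCM`) the André record AND the imaginary-quadratic anchor
leaf `DivisorGeneratedCMPointedWeilFamiliesQuadratic` are gone. CAVEAT (transport seat, verbatim): the CM-field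
anchor leaf quantifies over ALL CM fields; print gives its divisor-generation clause for anchor-good fields only.
[cite: Gordon1997, Thm. 6.4 and Prop. 9.4.1] [cite: Andre1992HodgeCM, Théorème and p. 2] -/
theorem hc_cm_of_divisorGeneratedCMPointed_of_localVHCAtCM
    (hP₃ : Ring2Transport.DivisorGeneratedCMPointedWeilFamiliesCMField) (hV : LocalVHCAtCM) :
    Theses.RankFourFaces.CMAbelianHodge :=
  hc_cm_of_weilClassesCMField (HC_WeilClassesCMField_of_divisorGeneratedCMPointed_of_localVHCAtCM hP₃ hV)

/-- **G4′ — `HC_AV` on the CM-pivot line, `HC_CM` discharged by the CM-field anchor leaf alone**: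
`DivisorGeneratedCMPointedWeilFamiliesCMField ∧ CMAnchoredFamilies ∧ LocalVHCAtCM ⟹ HC_AV` (part XIII's G4 without
the André record and without the quadratic anchor leaf). [cite: Deligne1982HodgeCycles, Prop. 6.1]
[cite: Andre1992HodgeCM, Théorème] [cite: CharlesSchnell2014Notes, Thm. 11.3.17] -/
theorem hc_av_of_divisorGeneratedCMPointed_of_cmAnchoredFamilies_of_localVHCAtCM
    (hP₃ : Ring2Transport.DivisorGeneratedCMPointedWeilFamiliesCMField) (hMT : CMAnchoredFamilies)
    (hV : LocalVHCAtCM) : Theses.PadicSemiregularLift.HodgeAbelianVarieties :=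
  hc_av_of_hc_cm_of_cmAnchoredFamilies_of_localVHCAtCM (hc_cm_of_divisorGeneratedCMPointed_of_localVHCAtCM hP₃ hV)
    hMT hV

/-! ## §3 The LEAD grammar: `HC_CM`-free twins with R3 ALONE, fact-free -/

/-- **`HC_CM`-FREE TWIN of every closing row, with R3 alone and no record.** If `HC_CM → B → HC_AV`
(`AbelianAll.ClosesWithCM B`), then `R3 → B → HC_AV` — the Weil column's `HC_AV_of_closesWithCM_of_weilRungs` without
R∞ and without André's record. [cite: Andre1992HodgeCM, Théorème and p. 2] -/
theorem hc_av_of_closesWithCM_of_weilClassesCMField {B : Prop} (hB : AbelianAll.ClosesWithCM B)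
    (h₃ : WeilTypeLadder.WeilClassesCMField) (b : B) : Theses.PadicSemiregularLift.HodgeAbelianVarieties :=
  hB (hc_cm_of_weilClassesCMField h₃) b

/-- In the grammar's words: next to the rung R3, `HC_CM` is IDLE for every closing candidate — `CMIdle (R3 ∧ B)`.
[cite: Andre1992HodgeCM, Théorème] -/
theorem cmIdle_weilClassesCMField_and_of_closesWithCM {B : Prop} (hB : AbelianAll.ClosesWithCM B) :
    AbelianAll.CMIdle (WeilTypeLadder.WeilClassesCMField ∧ B) :=
  fun h => hc_av_of_closesWithCM_of_weilClassesCMField hB h.1 h.2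

/-- **Exactness with the rung in place of `HC_CM`**: for every EXACT candidate (`HC_AV ↔ HC_CM ∧ B`),
`HC_AV ↔ R3 ∧ B`, fact-free. [cite: Andre1992HodgeCM, Théorème] [cite: CharlesSchnell2014Notes, Thm. 11.5.21] -/
theorem hc_av_iff_weilClassesCMField_and_of_exactWithCM {B : Prop} (hB : AbelianAll.ExactWithCM B) :
    Theses.PadicSemiregularLift.HodgeAbelianVarieties ↔ WeilTypeLadder.WeilClassesCMField ∧ B :=
  ⟨fun h => ⟨AbelianAll.onPathAV_weilClassesCMField h, (AbelianAll.exactWithCM_iff.1 hB).2 h⟩,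
    cmIdle_weilClassesCMField_and_of_closesWithCM (AbelianAll.exactWithCM_iff.1 hB).1⟩

/-- **The Weil column's exactness instance AS FILED, André's record DISCHARGED**: `HC_AV ↔ R∞ ∧ R3 ∧ CMToAbelian`
(`AbelianAll.iff_weilRungs_and_cmToAbelian`) with `hA := CorCM.AndreWeakForm.andre1992_…_holds` (cell pub-hodgecm2,
p244726; count once theirs). [cite: Andre1992HodgeCM, Théorème] [cite: CharlesSchnell2014Notes, Thm. 11.5.21] -/
theorem hc_av_iff_weilRungs_and_cmToAbelian :
    Theses.PadicSemiregularLift.HodgeAbelianVarieties ↔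
      WeilTypeLadder.WeilClassesImaginaryQuadratic ∧ WeilTypeLadder.WeilClassesCMField ∧
        Theses.RankFourFaces.CMToAbelian :=
  AbelianAll.iff_weilRungs_and_cmToAbelian
    AndreWeakForm.andre1992_hodgeClasses_cmAbelianVariety_mem_span_pullback_weilClasses_holds

end Summit.HodgeConjecture.HodgeConjecture.Ring2.Hypotheses

end
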